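import Summits.BirchSwinnertonDyer.BirchSwinnertonDyer.Theorems.PrintCFramBottomClassIndexLawFiveLeLevelDictionaryKummer
import Literature.NumberTheory.EllipticCurves.CanonicalPAdicHeightThetaProofs
import Mathlib.NumberTheory.Padics.HeightOneSpectrum
import HarnessLib

/-!
# Route `PrintCFram`, crux C2 `BottomClassIndexLawFiveLe` (stmt-BirchSwinnertonDyer-20372), line
# `eisenstein-resource-bdp-line` (LEAD g10, report §2(d)): **THE LEVEL DICTIONARY (α), THE `ℚ_p` BRIDGE** —
# the crux's level binder `∃ Q : W(ℚ_[p]), p • Q = W.toPadicPoint p P` (Mathlib's `ℚ_[p]`) delivers the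
# hypothesis `hloc` of the Kummer dichotomy at the place above `p` (the tree's completion `v.adicCompletion ℚ`)
# (cell `bsd-print-cfram`, width seat `bsd-line-cfram-p1-w4` g8; helper `--supports` 20372; 0 defs, 0 facts,
# 0 sorry)

HONEST FRAMING. Nothing about BSD is proved here, and nothing of any stub. The LEVEL binder of the crux's own
statement and of LEAD g10's `levelPos_imp_classFactor` is phrased with Mathlib's `p`-adic numbers
(`∃ Q : (W.baseChange ℚ_[p]).toAffine.Point, p • Q = W.toPadicPoint p P`), whereas the local kernels of the
tree's Galois cohomology (`WeierstrassCurve.torsionLocalKer`, `GreenbergSelmer.decomp`) live over the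
completion `v.adicCompletion ℚ` of `ℚ` at the finite place `v`. Mathlib's continuous `ℚ`-algebra isomorphism
`Rat.HeightOneSpectrum.adicCompletion.padicEquiv v : v.adicCompletion ℚ ≃A[ℚ] ℚ_[primesEquiv v]` transports
points (`Affine.Point.map`), so the binder at `ℚ_[p]` gives `m`-divisibility of `P` in `W(ℚ_v)` and hence, by
`kummerClassTorsion_mem_torsionLocalKer_of_baseChange_eq_zsmul`, the local triviality of the Kummer class at `v`.

* `primesEquiv_eq_of_natCast_mem` — the place `v` of `ℚ` with `(p) ⊆ v` has `primesEquiv v = p`.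
* `exists_baseChange_eq_zsmul_of_toPadicPoint` — `n • Q = toPadicPoint p P` in `W(ℚ_[p])` ⟹
  `P = n • R` in `W(ℚ_v)` (`R = Point.map (padicEquiv v)⁻¹ Q`, `Affine.Point.map_baseChange`).
* **`kummerClassTorsion_mem_torsionLocalKer_of_toPadicPoint`** — LEVEL ≥ 1 in the crux's `ℚ_[p]`-currency ⟹
  the Kummer class of `P` lies in `torsionLocalKer W (v.adicCompletion ℚ) n` — the hypothesis `hloc` of
  `unramified_quot_or_sub_of_kummer(_line)` at the place above `p`.

THEOREMS ONLY; no definition, no named fact, no `sorry`. BSD is not proved by any of this; no summit statement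
is proved by this seat. References: [SilvermanAEC2009] VIII.§2, X.§4; Mathlib
`Mathlib.NumberTheory.Padics.HeightOneSpectrum`; the LEAD g10 report §2(d).
-/

set_option autoImplicit false
-- `…BirchSwinnertonDyer.BirchSwinnertonDyer.Theorems…` is the problem's mandated namespace (D-0017).
set_option linter.dupNamespace false

noncomputable section

open scoped Classical

namespace Summit.BirchSwinnertonDyer.BirchSwinnertonDyer.Theorems.PrintCFram.LevelDictionary

open NumberField IsDedekindDomain Field WeierstrassCurve Rat.HeightOneSpectrum
open Literature.NumberTheory.EllipticCurves Literature.NumberTheory.GaloisRepresentations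

/-- **The place of `ℚ` above `p` is sent to `p` by Mathlib's `primesEquiv`.** If `(p : 𝓞 ℚ) ∈ v` for a prime
number `p` then `primesEquiv v = p` (the natural generator of `v ∩ ℤ` is a prime dividing `p`). [folklore] -/
theorem primesEquiv_eq_of_natCast_mem (v : HeightOneSpectrum (𝓞 ℚ)) {p : ℕ} (hp : p.Prime)
    (h : (p : 𝓞 ℚ) ∈ v.asIdeal) : (primesEquiv v : ℕ) = p := by
  have hmem : ((p : ℕ) : ℤ) ∈ v.asIdeal.map (Rat.IsIntegralClosure.intEquiv (𝓞 ℚ)) := by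
    have h' := Ideal.mem_map_of_mem (Rat.IsIntegralClosure.intEquiv (𝓞 ℚ)) h
    rwa [map_natCast] at h'
  have hdvd : natGenerator v ∣ p := (natGenerator_dvd_iff v).2 hmem
  exact (Nat.prime_dvd_prime_iff_eq (prime_natGenerator v) hp).1 hdvd

/-- **Points divisible at `ℚ_[p]` are divisible at `ℚ_v`.** For the finite place `v` of `ℚ` with
`primesEquiv v = p` and `P ∈ W(ℚ)`: if `n • Q = toPadicPoint p P` for some `Q ∈ W(ℚ_[p])`, then
`P = n • R` in `W(ℚ_v)` for `R` the transport of `Q` along `(padicEquiv v)⁻¹ : ℚ_[p] ≃ₐ[ℚ] ℚ_v`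
(`Affine.Point.map`, `Affine.Point.map_baseChange`). [folklore] -/
theorem exists_baseChange_eq_zsmul_of_toPadicPoint (W : WeierstrassCurve ℚ) (v : HeightOneSpectrum (𝓞 ℚ))
    {p : ℕ} [Fact p.Prime] (hv : (primesEquiv v : ℕ) = p) (P : W.toAffine.Point) {n : ℤ}
    {Q : (W.baseChange ℚ_[p]).toAffine.Point} (hQ : n • Q = W.toPadicPoint p P) :
    ∃ R : (W.baseChange (v.adicCompletion ℚ)).toAffine.Point,
      Affine.Point.baseChange (W' := W) ℚ (v.adicCompletion ℚ) P = n • R := by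
  subst hv
  let e : v.adicCompletion ℚ ≃ₐ[ℚ] ℚ_[(primesEquiv v : ℕ)] := (adicCompletion.padicEquiv v).toAlgEquiv
  refine ⟨Affine.Point.map (W' := W) (e.symm : ℚ_[(primesEquiv v : ℕ)] →ₐ[ℚ] v.adicCompletion ℚ) Q, ?_⟩
  rw [← map_zsmul, hQ]
  exact (Affine.Point.map_baseChange (W' := W) (F := ℚ)
    (e.symm : ℚ_[(primesEquiv v : ℕ)] →ₐ[ℚ] v.adicCompletion ℚ) P).symm

/-- **LEVEL ≥ 1 (the crux's `ℚ_[p]` binder) ⟹ the Kummer class is locally trivial at the place above `p`.**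
`W/ℚ`, `nQ̃ = P` in `W(ℚ̄)` with `P ∈ W(ℚ)`, `v` the finite place of `ℚ` with `(p) ⊆ v`; if
`n • Q = W.toPadicPoint p P` for some `Q ∈ W(ℚ_[p])` then the Kummer class `[σ ↦ σQ̃ − Q̃]` lies in
`torsionLocalKer W (v.adicCompletion ℚ) n` — the hypothesis `hloc` of `unramified_quot_or_sub_of_kummer` at `v`
(by `exists_baseChange_eq_zsmul_of_toPadicPoint` and `kummerClassTorsion_mem_torsionLocalKer_of_baseChange_eq_zsmul`).
[cite: SilvermanAEC2009, VIII.§2 and X.§4 (local Kummer sequence)] -/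
theorem kummerClassTorsion_mem_torsionLocalKer_of_toPadicPoint (W : WeierstrassCurve ℚ)
    (v : HeightOneSpectrum (𝓞 ℚ)) {p : ℕ} [Fact p.Prime] (hv : (p : 𝓞 ℚ) ∈ v.asIdeal)
    {n : ℤ} (Qt : geomPoints W)
    (hQfix : n • Qt ∈ MulAction.fixedPoints (absoluteGaloisGroup ℚ) (geomPoints W))
    (P : W.toAffine.Point) (hQt : n • Qt = toGeomPoints W P)
    (hlev : ∃ Q : (W.baseChange ℚ_[p]).toAffine.Point, n • Q = W.toPadicPoint p P) :
    kummerClassTorsion W n Qt hQfix ∈ W.torsionLocalKer (v.adicCompletion ℚ) n := by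
  obtain ⟨Q, hQ⟩ := hlev
  obtain ⟨R, hR⟩ := exists_baseChange_eq_zsmul_of_toPadicPoint W v
    (primesEquiv_eq_of_natCast_mem v (Fact.out : p.Prime) hv) P hQ
  exact kummerClassTorsion_mem_torsionLocalKer_of_baseChange_eq_zsmul W Qt hQfix P hQt
    (v.adicCompletion ℚ) R hR

/-- The same with the crux's literal binder `p • Q = W.toPadicPoint p P` (`p : ℕ` acting by `nsmul`) at
`n = p`. [cite: SilvermanAEC2009, VIII.§2 and X.§4 (local Kummer sequence)] -/
theorem kummerClassTorsion_mem_torsionLocalKer_of_toPadicPoint_nsmul (W : WeierstrassCurve ℚ)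
    (v : HeightOneSpectrum (𝓞 ℚ)) {p : ℕ} [Fact p.Prime] (hv : (p : 𝓞 ℚ) ∈ v.asIdeal)
    (Qt : geomPoints W)
    (hQfix : (p : ℤ) • Qt ∈ MulAction.fixedPoints (absoluteGaloisGroup ℚ) (geomPoints W))
    (P : W.toAffine.Point) (hQt : (p : ℤ) • Qt = toGeomPoints W P)
    (hlev : ∃ Q : (W.baseChange ℚ_[p]).toAffine.Point, p • Q = W.toPadicPoint p P) :
    kummerClassTorsion W (p : ℤ) Qt hQfix ∈ W.torsionLocalKer (v.adicCompletion ℚ) (p : ℤ) := by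
  obtain ⟨Q, hQ⟩ := hlev
  exact kummerClassTorsion_mem_torsionLocalKer_of_toPadicPoint W v hv Qt hQfix P hQt
    ⟨Q, by rw [natCast_zsmul]; exact hQ⟩

end Summit.BirchSwinnertonDyer.BirchSwinnertonDyer.Theorems.PrintCFram.LevelDictionary

end
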